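import Summits.CriticalPhenomena.PercolationContinuityZ3.Theorems.SahiBoxTP2Submodular
import Summits.CriticalPhenomena.PercolationContinuityZ3.Theorems.SahiBoxTP2GridThree

/-!
# `C₃` for Gibbs laws with submodular potential on `ℝ^d`, `d ≤ 3` (computational certificate inside)

Support file of the Sahi cell (`prim-sahi`, typer seat, generation 11; `--supports stmt-CriticalPhenomena-4575`).
COMPUTATIONAL: via `SahiGrid3.liebSahiContinuum_of_dim_le_three_three` (declared `native_decide` certificate).

* `msahiE_withDensity_pi_exp_neg_three_nonneg` — every probability law `e^{-V} · ⊗_j μ_j` on `ℝ^d`, `d ≤ 3`,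
  with measurable submodular `V` and σ-finite product reference satisfies
  `E₃(f,g,h) = 2⟨fgh⟩ + ⟨f⟩⟨g⟩⟨h⟩ − ⟨f⟩⟨gh⟩ − ⟨g⟩⟨fh⟩ − ⟨h⟩⟨fg⟩ ≥ 0` for bounded measurable nonnegative monotone
  `f, g, h`;
* `msahiE_quadPotential_three_nonneg` — in particular every Gaussian vector in `ℝ³` (or `ℝ²`, `ℝ`) whose precision
  matrix has nonpositive off-diagonal entries, with any mean, and every such law tilted by a separable potential.
No sorries; axioms standard + the declared certificate.
-/

noncomputable section

namespace Summit.CriticalPhenomena.PercolationContinuityZ3.Theorems.SahiBoxTP2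

open MeasureTheory Literature.Combinatorics.Sahi2008
open scoped ENNReal

variable {d : ℕ}

/-- **`C₃` for Gibbs laws with submodular potential on `ℝ^d`, `d ≤ 3`.** COMPUTATIONAL. [this work] -/
theorem msahiE_withDensity_pi_exp_neg_three_nonneg (hd : d ≤ 3) (μ : Fin d → Measure ℝ) [∀ i, SigmaFinite (μ i)]
    {V : (Fin d → ℝ) → ℝ} (hVm : Measurable V) (hV : ∀ x y, V (x ⊔ y) + V (x ⊓ y) ≤ V x + V y)
    [IsProbabilityMeasure ((Measure.pi μ).withDensity fun x => ENNReal.ofReal (Real.exp (-V x)))]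
    (f : Fin 3 → (Fin d → ℝ) → ℝ) (hfm : ∀ i, Measurable (f i)) (hf0 : ∀ i x, 0 ≤ f i x) {M : ℝ}
    (hfM : ∀ i x, f i x ≤ M) (hmono : ∀ i, Monotone (f i)) :
    0 ≤ msahiE ((Measure.pi μ).withDensity fun x => ENNReal.ofReal (Real.exp (-V x))) 3 f :=
  msahiE_withDensity_pi_exp_neg_nonneg_of_liebSahiContinuum (SahiGrid3.liebSahiContinuum_of_dim_le_three_three hd)
    μ hVm hV f hfm hf0 hfM hmono

/-- **`C₃` for Gaussian-type laws with M-matrix couplings on `ℝ^d`, `d ≤ 3`**: `exp(−Σ P_ij(x_i−m_i)(x_j−m_j) −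
Σ φ_i(x_i)) · ⊗_j μ_j`, `P_ij ≤ 0` for `i ≠ j`, normalised — e.g. `N(m, Σ)` on `ℝ³` with `(Σ⁻¹)_{ij} ≤ 0` for
`i ≠ j`: `E₃(f,g,h) ≥ 0` for bounded measurable nonnegative monotone `f, g, h`. COMPUTATIONAL. [this work] -/
theorem msahiE_quadPotential_three_nonneg (hd : d ≤ 3) (μ : Fin d → Measure ℝ) [∀ i, SigmaFinite (μ i)]
    {P : Fin d → Fin d → ℝ} (hP : ∀ i j, i ≠ j → P i j ≤ 0) (m : Fin d → ℝ) {φ : Fin d → ℝ → ℝ}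
    (hφ : ∀ i, Measurable (φ i))
    [IsProbabilityMeasure ((Measure.pi μ).withDensity fun x => ENNReal.ofReal (Real.exp (-quadPotential P m φ x)))]
    (f : Fin 3 → (Fin d → ℝ) → ℝ) (hfm : ∀ i, Measurable (f i)) (hf0 : ∀ i x, 0 ≤ f i x) {M : ℝ}
    (hfM : ∀ i x, f i x ≤ M) (hmono : ∀ i, Monotone (f i)) :
    0 ≤ msahiE ((Measure.pi μ).withDensity fun x => ENNReal.ofReal (Real.exp (-quadPotential P m φ x))) 3 f :=
  msahiE_withDensity_pi_exp_neg_three_nonneg hd μ (measurable_quadPotential P m hφ)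
    (quadPotential_submodular hP m φ) f hfm hf0 hfM hmono

end Summit.CriticalPhenomena.PercolationContinuityZ3.Theorems.SahiBoxTP2
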